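import Summits.QuantumAdvantage.QuantumAdvantage.Theses.WhiteBoxWalk
import Summits.QuantumAdvantage.QuantumAdvantage.Theses.PromiseLift

/-!
# Line `certified-canonical-lift` for crux `PlLift` / `WbwPromiseLift` (item stmt-QuantumAdvantage-0250)

Registered by planner-cstrat-stmt-QuantumAdvantage-0250-0 (crux-strategist, route WhiteBoxWalk), 2026-08-16.
Card: `Cruxes/PlLift/Lines/certified-canonical-lift.md`; census: `Cruxes/PlLift/STRATEGY-CENSUS.md`.

THE LINE (route-LOCAL bypass of the promise→language lift for WhiteBoxWalk's planted witness, the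
analogue of CubicForrelation's `SignedExactSliceIsLift`): the crux
`PlLift : BQP ⊆ BPP → PromiseBQP ⊆ PromiseBPP'` is `QuantumAdvantage ∨ (PromiseBQP ⊆ PromiseBPP')`
(Disproof.lean `plLift_iff`), relativized-FALSE (`Literature.Barriers.QuantumAdvantage.PromiseLiftRelativization`)
and, in its non-vacuous content, the complete-LANGUAGE problem for `BQP` (Obstructions.md B1–B3;
route PromiseLift items `PlPromiseIsLift`, `PlJonesExtends`). Route WhiteBoxWalk needs PL only to
carry ITS OWN planted witness `X = WbwThesis` from the promise level to the summit. This line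
replaces that use of PL by STRENGTHENING X:

* `WbwCertifiedThesis` (X_cert, stub, hypothesis-grade like the route's target `WbwThesis`, which it
  implies): the planted instances are CERTIFIED — a poly-time verifier `V` accepts every real instance
  `gen s`, and ONE uniform Clifford+T family is PSEUDO-DETERMINISTIC ON EVERY `V`-ACCEPTED INPUT
  (canonical answer `a x`, equal to `ans s` on `x = gen s`); classical hardness (C) verbatim as in X.
  Intended engine (informal, card §Engine): the rank-2 obfuscated glued-trees generator wrapped in the
  Badrinarayanan–Goyal–Jain–Sahai / Bitansky "2-of-3 commit-and-prove" certification with an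
  absolutely sound NIWI (Bitansky–Paneth: iO + one-way permutations) and perfectly correct iO, the
  kill schedule of the single-slot hybrid chain ordered EXIT-neighbourhood-first so that every
  certified slot is either walkable or flag-dead (walk dichotomy by fiat).
* `stub_certify : WbwCertifiedThesis → WbwCanonicalThesis` (provable now, M): fold the verifier into
  the family (`isQSolvable_classicalWrap_holds`; off the certified set the relation is `univ`, pattern
  `bitProblem_mem_PromiseBQP` in Theorems/WhiteBoxWalkWbwSearchToPromise.lean).
* `stub_canonical_lift : WbwCanonicalThesis → QuantumAdvantage` (provable now, L): the bit LANGUAGE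
  `{⟨x, v⟩ | bit |v| of a x is 1}` of an everywhere-canonical solver is in `BQP` (same wrap, trivial
  promise) and not in `BPP` (a BPP decider answers the `p(|x|)` bit queries with one coin string and
  recovers `ans s` for every `s`, contradicting (C); step 3 of `wbwSearchToPromise_proof` verbatim with
  `ofLanguage_mem_PromiseBPP'_iff`).
* Composition `PlLift_of` / `WbwPromiseLift_of` (hypotheses = the name-keyed aliases
  `Registered.stub_*`): X_cert, certify, lift ⊢ QuantumAdvantage ⊢ PL (`plLift_of_quantumAdvantage`,
  Disproof.lean §1). Sorry only inside `stub_*`.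

Honesty clause (costume check, stated plainly as TRIAGE-r1 did for rm-rigidity): the line closes PL
through S; its S-half `stub_certified_thesis` is hypothesis-grade (conjecture-strength, like
`WbwThesis`/`WbwEngine`'s antecedent) and is NOT claimed provable in the tree; the EARNED content is
the two arrows + the typed statements, which let a tenure planner re-cut the route as
`closes' : WbwCertifiedThesis → (certify) → (lift) → QuantumAdvantage` and drop stmt-0250 from
WhiteBoxWalk's wanted_by (as CubicForrelation did at rev 7). Disproof used: honours `not_plLift_iff`
(we go through the S disjunct), `not_semanticLiftSchema` (totality is manufactured from white-box
CERTIFICATES, not from acceptance probabilities), `PromiseLiftRelativization` (no oracle form: the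
certificate is part of the input; the local statement `BQP ⊆ BPP → Π_X ∈ PromiseBPP'` for a certified
Π_X is trivially true at every oracle).
-/

set_option linter.dupNamespace false

namespace Summit.QuantumAdvantage.QuantumAdvantage.Cruxes.PlLift.CertifiedCanonicalLift

open Filter Asymptotics
open Literature.Computability.Complexity Literature.Computability.Cryptography
open Summit.QuantumAdvantage.QuantumAdvantage.Theses

/-- **X_pd — planted unique-answer advantage with an EVERYWHERE-CANONICAL quantum solver.** As the
route's `WbwThesis` (poly-time `gen`, answers `ans`, classical hardness (C) verbatim), but the quantum
clause is strengthened from "outputs `ans s` on input `gen s`" to: there is a total answer map `a` with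
`a (gen s) = ans s`, `|a x| = p |x|`, and ONE uniform oracle-free Clifford+T family writes `a x` first
with probability `≥ 2/3` on EVERY input `x` (pseudo-deterministic everywhere, not only on the image of
`gen`). [cite: arXiv:2602.17647, Thm 1.7 (pseudo-deterministic quantum search ⇔ reducible to a BQP
decision LANGUAGE)] [cite: Goldreich2006, §1.1] -/
def WbwCanonicalThesis : Prop :=
  ∃ (gen ans a : List Bool → List Bool) (p : Polynomial ℕ),
    Literature.Computability.Complexity.PolyTimeComputable id id gen ∧
    (∀ s, a (gen s) = ans s) ∧ (∀ x, (a x).length = p.eval x.length) ∧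
    (∃ F : Literature.Computability.Cryptography.QCircuitFamily Literature.Computability.Cryptography.cliffordT,
      F.IsOracleFree ∧ F.IsUniform ∧ ∀ x, 2 / 3 ≤ F.kernelProb 0 x {y | a x <+: y}) ∧
    ∀ A : Literature.Computability.Complexity.RandAlg (List Bool) (List Bool),
      Literature.Computability.Cryptography.IsPPT A id →
        Asymptotics.SuperpolynomialDecay atTop (fun n : ℕ => (n : ℝ)) (fun n : ℕ =>
          Literature.Computability.Cryptography.uniformAvg n fun s => A.pr id
            (Literature.Computability.Complexity.boolPair (Computability.unaryEncodeNat n) (gen s)) {y | ans s <+: y})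

/-- **X_cert — CERTIFIED planting.** As `WbwCanonicalThesis`, but canonicity is only required on a
poly-time decidable instance set containing the image of `gen`: there is an instance verifier
`V : {0,1}* → {0,1}` with `(x ↦ [V x]) ∈ FP`, `V (gen s) = true` for all seeds, and ONE uniform
oracle-free Clifford+T family that writes the canonical answer `a x` first with probability `≥ 2/3` on
every input with `V x = true` (nothing is required where `V x = false`). This is the shape delivered by
absolutely sound one-message certification of planted instances (Grollmann–Selman's "injectivity
supplies totality", crypto form: certified/verifiable obfuscation). [cite: doi:10.1109/focs.2015.94,
§5 (hard SVL distribution from iO)] [cite: GrollmannSelman1988, Thm (P ≠ UP ↔ one-way injections)]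
[cite: Bitansky2017VRF = ECCC TR17-005, §1.2 Step 1 (2-of-3 commit-and-prove; NIWI absolute soundness)] -/
def WbwCertifiedThesis : Prop :=
  ∃ (gen ans a : List Bool → List Bool) (V : List Bool → Bool) (p : Polynomial ℕ),
    Literature.Computability.Complexity.PolyTimeComputable id id gen ∧
    (fun x => [V x]) ∈ Literature.Computability.Complexity.FP ∧ (∀ s, V (gen s) = true) ∧
    (∀ s, a (gen s) = ans s) ∧ (∀ x, (a x).length = p.eval x.length) ∧
    (∃ F : Literature.Computability.Cryptography.QCircuitFamily Literature.Computability.Cryptography.cliffordT,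
      F.IsOracleFree ∧ F.IsUniform ∧ ∀ x, V x = true → 2 / 3 ≤ F.kernelProb 0 x {y | a x <+: y}) ∧
    ∀ A : Literature.Computability.Complexity.RandAlg (List Bool) (List Bool),
      Literature.Computability.Cryptography.IsPPT A id →
        Asymptotics.SuperpolynomialDecay atTop (fun n : ℕ => (n : ℝ)) (fun n : ℕ =>
          Literature.Computability.Cryptography.uniformAvg n fun s => A.pr id
            (Literature.Computability.Complexity.boolPair (Computability.unaryEncodeNat n) (gen s)) {y | ans s <+: y})

/-! ## Registered stubs -/

/-- **stub (S-half, hypothesis-grade; the line's hardest and only non-provable-in-ZFC-today step).**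
Certified planting exists. Intended witness (card §Engine): three obfuscated glued-trees neighbour
circuits with INDEPENDENT internal naming keys and a shared exit handle `y = f(e)` (`f` injective
OWF), plus a NIWI proof that two of the three slots are certified members (genuine-with-exit-`e` or
EXIT-neighbourhood-dead) of the syntactic family; `V` = NIWI verifier; the quantum solver walks every
slot, accepts a found name `v` iff `f v = y` and `v` collects two local-consistency votes, and outputs
its bits. Classical hardness by slot-wise rank-2 chains with witness-pair rotation {1,2}→{1,3}→{2,3}
(Bitansky 2017 §1.2; BGJS16), ending in an all-dead hybrid whose witnesses are `e`-free.
Why it might fail: (i) the rank-2 single-slot chain itself (judge's key risk: undirected producers);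
(ii) NIWI from Shor-NEUTRAL assumptions is only known from iO + one-way PERMUTATIONS (Bitansky–Paneth
2015) or derandomization + TDPs (BOV07) — post-quantum OWPs are fine, but if only bilinear NIWI were
available the line would be Shor-redundant; (iii) a certified slot could still leak `e` if the
"genuine" syntactic class does not pin the ENTRANCE (it must certify `u_i = name_i(ROOT)`).
[cite: doi:10.1109/focs.2015.94, Prop 5.1 + Claim 5.1] [cite: arXiv:quant-ph/0209131, Thm 3, Thm 9]
[cite: Bitansky2017VRF = ECCC TR17-005, §1.2, Def 2.2] -/
theorem stub_certified_thesis : WbwCertifiedThesis := by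
  sorry

/-- **stub (plumbing, provable now, M).** Certification ⇒ canonicity everywhere: fold the verifier
into the family — new answer map `a' x := if V x then a x else replicate (p |x|) false`, new family =
classical wrap (`isQSolvable_classicalWrap_holds`) of the old one with post-processor
`⟨x, y⟩ ↦ if V x then y else 0^{p |x|}`; on `V x = false` the wrapped relation is hit with probability 1
(pattern: `bitProblem_mem_PromiseBQP`, relation `univ` off the promise). [cite: BernsteinVazirani1997,
§8 (classical computation inside BQP)] -/
theorem stub_certify : WbwCertifiedThesis → WbwCanonicalThesis := by
  sorry

/-- **stub (the local lift, provable now, L).** An everywhere-canonical planted solver gives a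
`BQP ∖ BPP` LANGUAGE outright: `L := {z | (a (fstF z))[|sndF z|]? = some true}` is in `BQP` (classical
wrap of the canonical family with pre-processor `fstF` and post-processor "bit `|v|` of the first
`p |x|` output wires", bounded error on EVERY string because `a` is total and canonical), and a `BPP`
machine for `L`, amplified to error `1/(3 p |x| + 1)` and queried at the `p |x|` positions with one coin
string (`AdBPPSim.accF`, union bound), outputs `ans s` with probability `≥ 2/3` on every `gen s`,
contradicting (C) (superpolynomial decay at exponent 0) — step 3 of `wbwSearchToPromise_proof` with
`ofLanguage_mem_PromiseBPP'_iff` in place of the `PromiseBPP'` hypothesis.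
[cite: arXiv:2602.17647, Thm 1.7] [cite: Goldreich2006, §1.1] -/
theorem stub_canonical_lift : WbwCanonicalThesis → QuantumAdvantage := by
  sorry

/-! ## Sanity: the strengthened theses imply the route's target `WbwThesis` (no sorry) -/

/-- `X_pd → X`: an everywhere-canonical solver in particular answers on the image of `gen`. [folklore] -/
theorem wbwThesis_of_canonical (h : WbwCanonicalThesis) : WhiteBoxWalk.WbwThesis := by
  obtain ⟨gen, ans, a, p, hgen, hag, hlen, ⟨F, hF, hU, hQ⟩, hC⟩ := h
  refine ⟨gen, ans, hgen, ⟨p, fun s => ?_⟩, ⟨F, hF, hU, fun s => ?_⟩, hC⟩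
  · rw [← hag s, hlen]
  · simpa [hag s] using hQ (gen s)

/-- `X_cert → X` likewise (canonicity on the certified set suffices on the image). [folklore] -/
theorem wbwThesis_of_certified (h : WbwCertifiedThesis) : WhiteBoxWalk.WbwThesis := by
  obtain ⟨gen, ans, a, V, p, hgen, -, hV, hag, hlen, ⟨F, hF, hU, hQ⟩, hC⟩ := h
  refine ⟨gen, ans, hgen, ⟨p, fun s => ?_⟩, ⟨F, hF, hU, fun s => ?_⟩, hC⟩
  · rw [← hag s, hlen]
  · simpa [hag s] using hQ (gen s) (hV s)

/-! ## Name-keyed aliases of the stub statements (the native skeleton audit admits a hypothesis of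
`PlLift_of` by the last name component of its head — same device as `Cruxes/AcZeroRung/Lines/*.lean`) -/

namespace Registered

/-- Alias of stub 1's statement keyed by the registered stub name. -/
abbrev stub_certified_thesis : Prop := WbwCertifiedThesis
/-- Alias of stub 2's statement keyed by the registered stub name. -/
abbrev stub_certify : Prop := WbwCertifiedThesis → WbwCanonicalThesis
/-- Alias of stub 3's statement keyed by the registered stub name. -/
abbrev stub_canonical_lift : Prop := WbwCanonicalThesis → QuantumAdvantage

end Registered

/-! ## Composition: the stubs conclude the crux BY NAME (kernel-checked, no sorry) -/

/-- **The line concludes `PlLift`** (route PromiseLift's decl of the shared item stmt-QuantumAdvantage-0250,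
the decl the skeleton audit keys on): certified planting, certification ⇒ canonicity, canonicity ⇒ a
`BQP ∖ BPP` language; then the promise lift holds because its antecedent `BQP ⊆ BPP` is refuted
(Disproof.lean `plLift_of_quantumAdvantage`). [folklore] -/
theorem PlLift_of (h₁ : Registered.stub_certified_thesis) (h₂ : Registered.stub_certify)
    (h₃ : Registered.stub_canonical_lift) : PromiseLift.PlLift := by
  intro hcollapse
  obtain ⟨L, hL, hLn⟩ := h₃ (h₂ h₁)
  exact absurd (hcollapse hL) hLn

/-- The same composition concluding route WhiteBoxWalk's decl `WbwPromiseLift` of the item (this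
seat's route; the two decls are syntactically identical, `rfl` below). [folklore] -/
theorem WbwPromiseLift_of (h₁ : Registered.stub_certified_thesis) (h₂ : Registered.stub_certify)
    (h₃ : Registered.stub_canonical_lift) : WhiteBoxWalk.WbwPromiseLift :=
  PlLift_of h₁ h₂ h₃

/-- The two route decls of the item are the same proposition. [folklore] -/
example : WhiteBoxWalk.WbwPromiseLift = PromiseLift.PlLift := rfl

/-- Wiring check: the registered stub theorems feed `PlLift_of` as stated (the aliases are
definitionally the stub statements). An unnamed `example`, so that `PlLift_of` /
`WbwPromiseLift_of` stay the only declarations concluding the crux decls by name. -/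
example : PromiseLift.PlLift := PlLift_of stub_certified_thesis stub_certify stub_canonical_lift

end Summit.QuantumAdvantage.QuantumAdvantage.Cruxes.PlLift.CertifiedCanonicalLift
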